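import Mathlib.NumberTheory.LocalField.Basic
import Mathlib.LinearAlgebra.SesquilinearForm.Basic
import Mathlib.LinearAlgebra.FiniteDimensional.Lemmas
import Mathlib.RingTheory.Henselian
import Mathlib.RingTheory.DiscreteValuationRing.Basic
import Mathlib.Tactic.ComputeDegree
import HarnessLib

/-!
# Self-dual Hermitian lattices over a non-archimedean local field: the swap theorem

Topic `NumberTheory/QuadraticForms`; namespace `Literature.NumberTheory.QuadraticForms.SelfDualLattice` (grouping
sub-namespace named after the object).  THEOREMS ONLY
(no definition, no named fact, no `sorry`).

**Setting.** `K` a non-archimedean local field (Mathlib `IsNonarchimedeanLocalField`, valuation ring `𝒪[K]`,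
a complete discrete valuation ring), `σ : K →+* K` a ring endomorphism preserving the valuation with `σ ∘ σ = id`
(the conjugation of a quadratic extension `K/K₀`, possibly RAMIFIED, or `σ = id`), `V` a finite-dimensional
`K`-vector space and `B : V →ₛₗ[σ] V →ₗ[K] K` a `σ`-sesquilinear form which is Hermitian
(`B y x = σ (B x y)`).  A *lattice* is a finitely generated `𝒪[K]`-submodule `L ≤ V`; inside a `K`-subspace
`W` it is *integral* if `B(L, L) ⊆ 𝒪[K]` and *self-dual in `W`* if moreover every `y ∈ W` with `B(L, y) ⊆ 𝒪[K]`
lies in `L` (all hypotheses are spelled out; nothing is bundled).  Throughout `2 ∈ 𝒪[K]ˣ` (odd residue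
characteristic).

**Main theorem** (`exists_isometry_swap`): for two self-dual lattices `L, M` in `W` there is an isometry `s` of
`(V, B)`, equal to the identity on `W^⊥`, with `s(L) = M` AND `s(M) = L` — the two lattices are SWAPPED.  Applied to
`L₀` and `g L₀` for `g` in the unitary group `U(B)` and `L₀` self-dual this is the symmetry `g⁻¹ ∈ K g K` of the
double cosets of the stabiliser `K = U(L₀)` (file `NumberTheory/Automorphic/UnitaryGroupSymmetricDoubleCosets`),
i.e. the input of Gelfand's trick for the commutativity of the spherical Hecke algebra of a unitary group at a
place where the Hermitian form is unimodular ([GetzHahn2024] Thm. 5.5.1 with Exercise 5.14; classically deduced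
from the Cartan decomposition, [BruhatTits1972] 4.4.3, [Tits1979] 3.3.3).

**Proof** (lattice-pair version of the elementary-divisor / hyperbolic-splitting argument for Hermitian lattices,
[Jacobowitz1962] §§4–7; the Hensel lifting of isotropic vectors in self-dual lattices is [MoeglinVignerasWaldspurger1987]
Ch. 5 §II.1): induction on `dim W`.  If `M ⊄ L` let `r ≥ 1` be least with `ϖ^r M ⊆ L` (then also `ϖ^r L ⊆ M` by
duality) and pick `x ∈ M` with `u = ϖ^r x ∈ L` primitive.  Self-duality gives `y ∈ L` with `B(u, y) = 1`
(`exists_mem_apply_eq_one`); ONE application of Hensel's lemma to `X² + 2X + B(u,u)B(y,y)` makes `y` isotropic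
(`exists_isotropic_add_smul`), after which all further corrections are LINEAR (`b ↦ ⅟2`): one obtains isotropic
`a ∈ M`, `b' ∈ L` with `a' := ϖ^r a ∈ L`, `b := σ(ϖ)^r b' ∈ M` and `B(a, b) = B(a', b') = 1`
(`exists_adapted_hyperbolic_pair`).  The plane `P = ⟨a, b'⟩` splits both lattices, the map
`m ↦ m + B(b, m)(b' - a) + B(a, m)(a' - b)` is an isometry of `V` exchanging `(a, b) ↔ (b', a')` and fixing `P^⊥`
(`hyperbolic_swap_isometry`), and the induction hypothesis in `W ∩ P^⊥` finishes.  No diagonal/torus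
representatives, no Witt cancellation and no classification of unimodular lattices are used, and `K/K₀` need not be
unramified.

Written for the rung-0 debt row IV-9 `HyperspecialGelfandPair` of the cell `hodgecm-mathlib` (line
`b4-hyperspecial-gelfand-pair`, node (2L) `LocalSymmetric`, token `lattice-pair-invariants`).  HC_CM is proved only
modulo the 7 printed citations until rung 0 of that ladder closes; this file is unconditional and touches no binder.

## References
* [Jacobowitz1962] R. Jacobowitz, *Hermitian forms over local fields*, Amer. J. Math. 84 (1962), §§4–7.
* [MoeglinVignerasWaldspurger1987] C. Mœglin, M.-F. Vignéras, J.-L. Waldspurger, *Correspondances de Howe sur un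
  corps p-adique*, LNM 1291 (1987), Ch. 5 §II.1–II.7 (réseaux autoduaux).
* [GetzHahn2024] J. R. Getz, H. Hahn, *An Introduction to Automorphic Representations* (2024), Thm. 5.5.1, Exercise 5.14.
* [BruhatTits1972] F. Bruhat, J. Tits, *Groupes réductifs sur un corps local I*, Publ. IHÉS 41 (1972), 4.4.3.
* [Tits1979] J. Tits, *Reductive groups over local fields*, Corvallis (1979), §3.3.3.
* [SerreLocalFields1979] J.-P. Serre, *Local Fields* (1979), Ch. II §4 Prop. 7 (Hensel).
-/

noncomputable section

open ValuativeRel Polynomial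

namespace Literature.NumberTheory.QuadraticForms.SelfDualLattice

/-! ## §1 The valuation ring `𝒪[K]`: units, uniformizers, Hensel's lemma -/

section Valuative

variable {K : Type*} [Field K] [ValuativeRel K]

/-- Units of the valuation ring have valuation `1`. [cite: SerreLocalFields1979, Ch. I §1] -/
theorem valuation_eq_one_of_isUnit_integer {a : 𝒪[K]} (ha : IsUnit a) : valuation K (a : K) = 1 :=
  (Valuation.integer.integers (valuation K)).isUnit_iff_valuation_eq_one.mp ha

/-- The numeral `2` of `𝒪[K]` coerces to the numeral `2` of `K`. [folklore] -/
private theorem coe_integer_two : ((2 : 𝒪[K]) : K) = 2 := by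
  rw [← one_add_one_eq_two, Subring.coe_add, Subring.coe_one, one_add_one_eq_two]

/-- The maximal ideal of `𝒪[K]` is the set of elements of valuation `< 1`. [cite: SerreLocalFields1979, Ch. I §1] -/
theorem mem_maximalIdeal_iff_valuation_lt_one {a : 𝒪[K]} : a ∈ 𝓂[K] ↔ valuation K (a : K) < 1 := by
  rw [IsLocalRing.mem_maximalIdeal, mem_nonunits_iff, Valuation.Integer.not_isUnit_iff_valuation_lt_one]

variable {ϖ : 𝒪[K]}

/-- An irreducible element (uniformizer) of `𝒪[K]` is non-zero in `K`. [folklore] -/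
private theorem coe_ne_zero_of_irreducible (hϖ : Irreducible ϖ) : (ϖ : K) ≠ 0 := by
  intro h
  exact hϖ.ne_zero (Subtype.ext h)

/-- A uniformizer has valuation `< 1`. [cite: SerreLocalFields1979, Ch. I §1] -/
theorem valuation_lt_one_of_irreducible (hϖ : Irreducible ϖ) : valuation K (ϖ : K) < 1 :=
  Valuation.Integer.not_isUnit_iff_valuation_lt_one.mp hϖ.not_isUnit

/-- An element of valuation `1` has an integral inverse. [folklore] -/
private theorem inv_mem_integer_of_valuation_eq_one {t : K} (ht : valuation K t = 1) : t⁻¹ ∈ 𝒪[K] := by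
  rw [Valuation.mem_integer_iff, map_inv₀, ht, inv_one]

/-- `v(1 + a b) = 1` for `v(a) ≤ 1`, `v(b) < 1`. [folklore] -/
private theorem valuation_one_add_mul_eq_one {a b : K} (ha : valuation K a ≤ 1) (hb : valuation K b < 1) :
    valuation K (1 + a * b) = 1 := by
  apply Valuation.map_one_add_of_lt
  rw [map_mul]
  calc valuation K a * valuation K b ≤ 1 * valuation K b := by gcongr
    _ < 1 := by rwa [one_mul]

end Valuative

section LocalField

variable {K : Type*} [Field K] [ValuativeRel K] [TopologicalSpace K] [IsNonarchimedeanLocalField K]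

/-- **Hensel's lemma**: the valuation ring of a non-archimedean local field is Henselian (it is
`𝓂`-adically complete: Mathlib `IsAdicComplete 𝓂[K] 𝒪[K]` and `IsAdicComplete.henselianRing`). [cite: SerreLocalFields1979, Ch. II §4 Prop. 7] -/
theorem henselianLocalRing_integer_of_isNonarchimedeanLocalField : HenselianLocalRing 𝒪[K] := by
  letI := IsTopologicalAddGroup.rightUniformSpace K
  haveI := isUniformAddGroup_of_addCommGroup (G := K)
  exact
    { is_henselian := fun f hf a₀ h₁ h₂ =>
        HenselianRing.is_henselian (I := 𝓂[K]) f hf a₀ h₁ (h₂.map _) }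

/-- Hensel's lemma for `X² + 2X + e`, `e ∈ 𝓂`, in odd residue characteristic: a root `ν ∈ 𝓂` (the residual root
`0` is simple since the derivative there is `2 ∈ 𝒪ˣ`). [cite: SerreLocalFields1979, Ch. II §4 Prop. 7] -/
theorem exists_root_sq_add_two_mul_add (h2 : IsUnit (2 : 𝒪[K])) {e : 𝒪[K]} (he : e ∈ 𝓂[K]) :
    ∃ ν : 𝒪[K], ν ∈ 𝓂[K] ∧ ν ^ 2 + 2 * ν + e = 0 := by
  haveI := henselianLocalRing_integer_of_isNonarchimedeanLocalField (K := K)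
  have hmonic : (X ^ 2 + C (2 : 𝒪[K]) * X + C e).Monic := by
    monicity!
  obtain ⟨ν, hroot, hν⟩ := HenselianLocalRing.is_henselian (X ^ 2 + C (2 : 𝒪[K]) * X + C e) hmonic 0
    (by simpa using he) (by simpa using h2)
  refine ⟨ν, by simpa using hν, ?_⟩
  have h := hroot.eq_zero
  simpa [eval_add, eval_mul, eval_pow, eval_X, eval_C] using h

variable {ϖ : 𝒪[K]}

/-- Elements of valuation `< 1` are multiples of a uniformizer `ϖ` (`𝓂 = ϖ𝒪`, Mathlib
`IsDiscreteValuationRing.irreducible_iff_uniformizer`). [cite: SerreLocalFields1979, Ch. I §1] -/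
theorem exists_eq_mul_of_valuation_lt_one (hϖ : Irreducible ϖ) {a : K} (ha : valuation K a < 1) :
    ∃ b ∈ 𝒪[K], a = ϖ * b := by
  have haO : a ∈ 𝒪[K] := (Valuation.mem_integer_iff _ _).mpr ha.le
  have hmem : (⟨a, haO⟩ : 𝒪[K]) ∈ 𝓂[K] := mem_maximalIdeal_iff_valuation_lt_one.mpr ha
  rw [(IsDiscreteValuationRing.irreducible_iff_uniformizer ϖ).mp hϖ, Ideal.mem_span_singleton'] at hmem
  obtain ⟨b, hb⟩ := hmem
  refine ⟨b, b.2, ?_⟩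
  have := congrArg Subtype.val hb
  simpa [mul_comm] using this.symm

/-- Every element of `K` becomes integral after multiplication by a power of a uniformizer (`K = 𝒪[ϖ⁻¹]`). [cite: SerreLocalFields1979, Ch. I §1] -/
theorem exists_pow_mul_mem_integer (hϖ : Irreducible ϖ) (x : K) : ∃ n : ℕ, (ϖ : K) ^ n * x ∈ 𝒪[K] := by
  by_cases hx : valuation K x ≤ 1
  · exact ⟨0, by simpa using (Valuation.mem_integer_iff _ _).mpr hx⟩
  · have hx0 : x ≠ 0 := by
      rintro rfl
      exact hx (by simp)
    have hxi : valuation K x⁻¹ ≤ 1 := by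
      rw [map_inv₀]
      exact inv_le_one_of_one_le₀ (le_of_not_ge hx)
    have hne : (⟨x⁻¹, (Valuation.mem_integer_iff _ _).mpr hxi⟩ : 𝒪[K]) ≠ 0 := by
      intro h
      have := congrArg Subtype.val h
      simp [hx0] at this
    obtain ⟨n, u, hu⟩ := IsDiscreteValuationRing.eq_unit_mul_pow_irreducible hne hϖ
    have hK : x⁻¹ = (u : 𝒪[K]) * (ϖ : K) ^ n := by
      have := congrArg Subtype.val hu
      simpa using this
    refine ⟨n, ?_⟩
    have h1 : (ϖ : K) ^ n * x * ((u : 𝒪[K]) : K) = 1 := by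
      have := mul_inv_cancel₀ hx0
      rw [hK] at this
      linear_combination this
    have hinv : (((u⁻¹ : 𝒪[K]ˣ) : 𝒪[K]) : K) = (((u : 𝒪[K]) : K))⁻¹ := by
      apply eq_inv_of_mul_eq_one_left
      rw [← Subring.coe_mul, Units.inv_mul, Subring.coe_one]
    have hval : (ϖ : K) ^ n * x = ((u⁻¹ : 𝒪[K]ˣ) : 𝒪[K]) := by
      rw [hinv]
      exact eq_inv_of_mul_eq_one_left h1
    rw [hval]
    exact SetLike.coe_mem _

end LocalField

/-! ## §2 Hermitian lattices: integrality, self-duality, hyperbolic pairs -/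

section Lattice

variable {K : Type*} [Field K] [ValuativeRel K]
variable {V : Type*} [AddCommGroup V] [Module K V]
variable (σ : K →+* K) (B : V →ₛₗ[σ] V →ₗ[K] K)

/-- Scalar action of an integral element of `K` on an `𝒪[K]`-lattice. [folklore] -/
private theorem smul_mem_of_mem_integer {L : Submodule 𝒪[K] V} {a : K} (ha : a ∈ 𝒪[K]) {x : V} (hx : x ∈ L) :
    a • x ∈ L :=
  L.smul_mem ⟨a, ha⟩ hx

omit [ValuativeRel K] in
/-- Sesquilinearity in the first variable: `B (a • x) y = σ a * B x y`. [folklore] -/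
private theorem apply_smul_left (a : K) (x y : V) : B (a • x) y = σ a * B x y := by
  rw [LinearMap.map_smulₛₗ₂, smul_eq_mul]

omit [ValuativeRel K] in
/-- Linearity in the second variable: `B x (a • y) = a * B x y`. [folklore] -/
private theorem apply_smul_right (a : K) (x y : V) : B x (a • y) = a * B x y := by
  rw [map_smul, smul_eq_mul]

omit [ValuativeRel K] in
/-- For a hyperbolic pair `(c, d)` (`B(c,c) = B(d,d) = 0`, `B(c,d) = 1`) the vector `x - B(d,x) c - B(c,x) d` is orthogonal
to `c` and `d`. [cite: Jacobowitz1962, §4] -/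
theorem hyperbolic_residual_ortho (hB : ∀ x y, B y x = σ (B x y)) {c d : V} (hcc : B c c = 0) (hdd : B d d = 0)
    (hcd : B c d = 1) (x : V) :
    B c (x - (B d x) • c - (B c x) • d) = 0 ∧ B d (x - (B d x) • c - (B c x) • d) = 0 := by
  have hdc : B d c = 1 := by rw [hB, hcd, map_one]
  constructor
  · simp only [map_sub, map_smul, smul_eq_mul, hcc, hcd, mul_zero, mul_one, sub_zero, sub_self]
  · simp only [map_sub, map_smul, smul_eq_mul, hdd, hdc, mul_zero, mul_one, sub_self]

/-- For `c, d, x` in an integral lattice `X`, the residual `x - B(d,x) c - B(c,x) d` lies in `X`. [cite: Jacobowitz1962, §4] -/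
theorem hyperbolic_residual_mem {X : Submodule 𝒪[K] V} (hX : ∀ x ∈ X, ∀ y ∈ X, B x y ∈ 𝒪[K])
    {c d x : V} (hc : c ∈ X) (hd : d ∈ X) (hx : x ∈ X) :
    x - (B d x) • c - (B c x) • d ∈ X :=
  X.sub_mem (X.sub_mem hx (smul_mem_of_mem_integer (hX d hd x hx) hc))
    (smul_mem_of_mem_integer (hX c hc x hx) hd)

/-- **Splitting a hyperbolic plane off an integral lattice**, as a containment criterion: if `X` is integral and
contains the hyperbolic pair `(c, d)`, then `X ≤ N` as soon as `c, d ∈ N` and every element of `X` orthogonal to `c, d`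
lies in `N` (i.e. `X = 𝒪c ⊕ 𝒪d ⊕ (X ∩ ⟨c,d⟩^⊥)`). [cite: Jacobowitz1962, §4] -/
theorem le_of_hyperbolic_pair (hB : ∀ x y, B y x = σ (B x y)) {X N : Submodule 𝒪[K] V} {c d : V}
    (hcc : B c c = 0) (hdd : B d d = 0) (hcd : B c d = 1) (hc : c ∈ X) (hd : d ∈ X)
    (hX : ∀ x ∈ X, ∀ y ∈ X, B x y ∈ 𝒪[K]) (hcN : c ∈ N) (hdN : d ∈ N)
    (hq : ∀ q ∈ X, B c q = 0 → B d q = 0 → q ∈ N) : X ≤ N := by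
  intro x hx
  obtain ⟨h1, h2⟩ := hyperbolic_residual_ortho σ B hB hcc hdd hcd x
  have hqN := hq _ (hyperbolic_residual_mem σ B hX hc hd hx) h1 h2
  have hsum : x = (x - (B d x) • c - (B c x) • d) + (B d x) • c + (B c x) • d := by abel
  rw [hsum]
  exact N.add_mem (N.add_mem hqN (smul_mem_of_mem_integer (hX d hd x hx) hcN))
    (smul_mem_of_mem_integer (hX c hc x hx) hdN)

variable {σ B}

/-- **A primitive vector of a self-dual lattice has a partner**: if `L` is self-dual in `W`, `u ∈ L` and `ϖ⁻¹ u ∉ L`,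
then `B(u, y) = 1` for some `y ∈ L` (otherwise `B(L, ϖ⁻¹u) ⊆ 𝒪`, forcing `ϖ⁻¹ u ∈ L`).
[cite: MoeglinVignerasWaldspurger1987, Ch. 5 §II.1] -/
theorem exists_mem_apply_eq_one (hσv : ∀ x, valuation K (σ x) = valuation K x)
    (hB : ∀ x y, B y x = σ (B x y)) {ϖ : 𝒪[K]} (hϖ : Irreducible ϖ)
    (hϖm : ∀ a : K, valuation K a < 1 → ∃ b ∈ 𝒪[K], a = ϖ * b)
    {W : Submodule K V} {L : Submodule 𝒪[K] V}
    (hLint : ∀ x ∈ L, ∀ y ∈ L, B x y ∈ 𝒪[K]) (hLdual : ∀ y ∈ W, (∀ x ∈ L, B x y ∈ 𝒪[K]) → y ∈ L)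
    (hLW : ∀ x ∈ L, x ∈ W) {u : V} (hu : u ∈ L) (hprim : (ϖ : K)⁻¹ • u ∉ L) :
    ∃ y ∈ L, B u y = 1 := by
  have hϖ0 := coe_ne_zero_of_irreducible hϖ
  suffices h : ∃ y ∈ L, valuation K (B u y) = 1 by
    obtain ⟨y, hy, hv⟩ := h
    have hne : B u y ≠ 0 := fun h0 => by simp [h0] at hv
    refine ⟨(B u y)⁻¹ • y, smul_mem_of_mem_integer (inv_mem_integer_of_valuation_eq_one hv) hy, ?_⟩
    rw [apply_smul_right, inv_mul_cancel₀ hne]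
  by_contra hne
  push Not at hne
  apply hprim
  apply hLdual _ (W.smul_mem _ (hLW u hu))
  intro x hx
  have hlt : valuation K (B u x) < 1 :=
    lt_of_le_of_ne ((Valuation.mem_integer_iff _ _).mp (hLint u hu x hx)) (hne x hx)
  obtain ⟨b, hb, hbeq⟩ := hϖm _ hlt
  have hxu : B x u = σ (B u x) := hB u x
  rw [apply_smul_right, hxu, hbeq, map_mul, ← mul_assoc]
  have h1 : valuation K ((ϖ : K)⁻¹ * σ ϖ) = 1 := by
    rw [map_mul, map_inv₀, hσv, inv_mul_cancel₀]
    exact (Valuation.ne_zero_iff _).mpr hϖ0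
  rw [Valuation.mem_integer_iff, map_mul, h1, one_mul, hσv]
  exact ((Valuation.mem_integer_iff _ _).mp hb)

/-- For a finitely generated lattice `L` and any vector `m`, `B(L, ϖⁿ m) ⊆ 𝒪[K]` for `n` large (bounded denominators on a
finite generating set). [folklore] -/
private theorem exists_pow_smul_forall_apply_mem (hσv : ∀ x, valuation K (σ x) = valuation K x)
    {ϖ : 𝒪[K]} (hpow : ∀ x : K, ∃ n : ℕ, (ϖ : K) ^ n * x ∈ 𝒪[K])
    {L : Submodule 𝒪[K] V} (hLfg : L.FG) (m : V) :
    ∃ n : ℕ, ∀ x ∈ L, B x (((ϖ : K) ^ n) • m) ∈ 𝒪[K] := by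
  classical
  obtain ⟨S, hS⟩ := hLfg
  choose f hf using fun x : V => hpow (B x m)
  refine ⟨S.sup f, fun x hx => ?_⟩
  rw [← hS] at hx
  induction hx using Submodule.span_induction with
  | mem x hxS =>
    have hle : f x ≤ S.sup f := Finset.le_sup hxS
    obtain ⟨k, hk⟩ := Nat.exists_eq_add_of_le hle
    rw [apply_smul_right, hk, pow_add, mul_comm ((ϖ : K) ^ f x), mul_assoc]
    exact Subring.mul_mem _ (Subring.pow_mem _ ϖ.2 _) (hf x)
  | zero => simp
  | add x y _ _ hx hy =>
    rw [map_add, LinearMap.add_apply]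
    exact Subring.add_mem _ hx hy
  | smul a x _ hx =>
    rw [show a • x = (a : K) • x from rfl, apply_smul_left]
    refine Subring.mul_mem _ ?_ hx
    rw [Valuation.mem_integer_iff, hσv]
    exact a.2

/-- A self-dual finitely generated lattice absorbs every vector of its ambient space: `ϖⁿ m ∈ L` for `n` large. [folklore] -/
private theorem exists_pow_smul_mem (hσv : ∀ x, valuation K (σ x) = valuation K x)
    {ϖ : 𝒪[K]} (hpow : ∀ x : K, ∃ n : ℕ, (ϖ : K) ^ n * x ∈ 𝒪[K])
    {W : Submodule K V} {L : Submodule 𝒪[K] V} (hLfg : L.FG)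
    (hLdual : ∀ y ∈ W, (∀ x ∈ L, B x y ∈ 𝒪[K]) → y ∈ L) {m : V} (hm : m ∈ W) :
    ∃ n : ℕ, ((ϖ : K) ^ n) • m ∈ L := by
  obtain ⟨n, hn⟩ := exists_pow_smul_forall_apply_mem (B := B) hσv hpow hLfg m
  exact ⟨n, hLdual _ (W.smul_mem _ hm) hn⟩

/-- Uniform absorption: for `M` finitely generated inside the ambient space of the self-dual lattice `L`, `ϖⁿ M ⊆ L` for
`n` large. [folklore] -/
private theorem exists_pow_forall_smul_mem (hσv : ∀ x, valuation K (σ x) = valuation K x)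
    {ϖ : 𝒪[K]} (hpow : ∀ x : K, ∃ n : ℕ, (ϖ : K) ^ n * x ∈ 𝒪[K])
    {W : Submodule K V} {L M : Submodule 𝒪[K] V} (hLfg : L.FG) (hMfg : M.FG)
    (hLdual : ∀ y ∈ W, (∀ x ∈ L, B x y ∈ 𝒪[K]) → y ∈ L) (hMW : ∀ x ∈ M, x ∈ W) :
    ∃ n : ℕ, ∀ m ∈ M, ((ϖ : K) ^ n) • m ∈ L := by
  classical
  obtain ⟨S, hS⟩ := hMfg
  have hSW : ∀ m ∈ S, m ∈ W := fun m hm => hMW m (hS ▸ Submodule.subset_span hm)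
  choose f hf using fun m : S => exists_pow_smul_mem (B := B) hσv hpow hLfg hLdual (hSW m.1 m.2)
  refine ⟨Finset.univ.sup f, fun m hm => ?_⟩
  rw [← hS] at hm
  induction hm using Submodule.span_induction with
  | mem x hxS =>
    have hle : f ⟨x, hxS⟩ ≤ Finset.univ.sup f := Finset.le_sup (Finset.mem_univ _)
    obtain ⟨k, hk⟩ := Nat.exists_eq_add_of_le hle
    rw [hk, pow_add, mul_comm, mul_smul]
    exact smul_mem_of_mem_integer (Subring.pow_mem _ ϖ.2 _) (hf ⟨x, hxS⟩)
  | zero => simp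
  | add x y _ _ hx hy =>
    rw [smul_add]
    exact L.add_mem hx hy
  | smul a x _ hx =>
    rw [smul_comm]
    exact L.smul_mem a hx

/-- **Duality transfer**: if `L` is integral, `M` is self-dual in `W ⊇ L` and `ϖ^r M ⊆ L`, then `ϖ^r L ⊆ M`
(`B(M, ϖ^r l) = ϖ^r σ(B(l, M))` is integral since `B(l, ϖ^r M) ⊆ B(L, L)`). [cite: MoeglinVignerasWaldspurger1987, Ch. 5 §II.7] -/
theorem pow_smul_mem_of_forall_pow_smul_mem (hσv : ∀ x, valuation K (σ x) = valuation K x)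
    (hB : ∀ x y, B y x = σ (B x y)) {ϖ : 𝒪[K]}
    {W : Submodule K V} {L M : Submodule 𝒪[K] V}
    (hLint : ∀ x ∈ L, ∀ y ∈ L, B x y ∈ 𝒪[K])
    (hMdual : ∀ y ∈ W, (∀ x ∈ M, B x y ∈ 𝒪[K]) → y ∈ M) (hLW : ∀ x ∈ L, x ∈ W) {r : ℕ}
    (hML : ∀ m ∈ M, ((ϖ : K) ^ r) • m ∈ L) {l : V} (hl : l ∈ L) : ((ϖ : K) ^ r) • l ∈ M := by
  apply hMdual _ (W.smul_mem _ (hLW l hl))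
  intro m hm
  have h1 : B l (((ϖ : K) ^ r) • m) ∈ 𝒪[K] := hLint l hl _ (hML m hm)
  rw [apply_smul_right] at h1
  rw [apply_smul_right, hB l m, Valuation.mem_integer_iff, map_mul, ← hσv ((ϖ : K) ^ r), ← map_mul,
    ← map_mul, hσv]
  exact (Valuation.mem_integer_iff _ _).mp h1

end Lattice

/-! ## §3 Exact isotropy: one Hensel step and linear corrections -/

section Isotropy

variable {K : Type*} [Field K] [ValuativeRel K] [TopologicalSpace K] [IsNonarchimedeanLocalField K]
variable {V : Type*} [AddCommGroup V] [Module K V]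
variable {σ : K →+* K} {B : V →ₛₗ[σ] V →ₗ[K] K}

/-- **Isotropic partner by one Hensel step**: if `B(u, y) = 1`, `v(B(u,u)) < 1` and `B(y,y) ∈ 𝒪`, there is a `σ`-fixed
`μ ∈ 𝒪[K]` with `y + μ u` isotropic — `μ = -B(y,y)/(ν + 2)` for the Hensel root `ν ∈ 𝓂` of `X² + 2X + B(u,u)B(y,y)`
(which is `σ`-fixed by uniqueness of the root in `𝓂`).  Odd residue characteristic. [cite: MoeglinVignerasWaldspurger1987, Ch. 5 §II.1] -/
theorem exists_isotropic_add_smul (h2 : IsUnit (2 : 𝒪[K]))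
    (hσv : ∀ x, valuation K (σ x) = valuation K x)
    (hB : ∀ x y, B y x = σ (B x y)) {u y : V} (huy : B u y = 1)
    (hc : valuation K (B u u) < 1) (hd : B y y ∈ 𝒪[K]) :
    ∃ μ : K, μ ∈ 𝒪[K] ∧ σ μ = μ ∧ B (y + μ • u) (y + μ • u) = 0 := by
  have hcσ : σ (B u u) = B u u := (hB u u).symm
  have hdσ : σ (B y y) = B y y := (hB y y).symm
  have hcO : B u u ∈ 𝒪[K] := (Valuation.mem_integer_iff _ _).mpr hc.le
  have hdv : valuation K (B y y) ≤ 1 := (Valuation.mem_integer_iff _ _).mp hd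
  have he : (⟨B u u * B y y, Subring.mul_mem _ hcO hd⟩ : 𝒪[K]) ∈ 𝓂[K] := by
    rw [mem_maximalIdeal_iff_valuation_lt_one]
    change valuation K (B u u * B y y) < 1
    rw [map_mul]
    calc valuation K (B u u) * valuation K (B y y) ≤ valuation K (B u u) * 1 := by gcongr
      _ < 1 := by rwa [mul_one]
  obtain ⟨ν, hνm, hν⟩ := exists_root_sq_add_two_mul_add h2 he
  have hνK : (ν : K) ^ 2 + 2 * ν + B u u * B y y = 0 := by
    have := congrArg Subtype.val hν
    simpa [coe_integer_two] using this
  have hνv : valuation K (ν : K) < 1 := mem_maximalIdeal_iff_valuation_lt_one.mp hνm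
  have h2v : valuation K (2 : K) = 1 := by
    have := valuation_eq_one_of_isUnit_integer h2
    simpa [coe_integer_two] using this
  have hσν : σ ν = ν := by
    have hroot' : (σ ν) ^ 2 + 2 * σ ν + B u u * B y y = 0 := by
      have := congrArg σ hνK
      simpa [map_add, map_mul, map_pow, map_ofNat, hcσ, hdσ] using this
    have hprod : ((ν : K) - σ ν) * (ν + σ ν + 2) = 0 := by linear_combination hνK - hroot'
    rcases mul_eq_zero.mp hprod with h | h
    · exact (sub_eq_zero.mp h).symm
    · exfalso
      have h2eq : (2 : K) = -((ν : K) + σ ν) := by linear_combination h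
      have hlt : valuation K (2 : K) < 1 := by
        rw [h2eq, Valuation.map_neg]
        refine lt_of_le_of_lt (Valuation.map_add _ _ _) (max_lt hνv ?_)
        rwa [hσv]
      exact absurd h2v (ne_of_lt hlt)
  have hν2 : valuation K ((ν : K) + 2) = 1 := by
    rw [add_comm, (valuation K).map_add_eq_of_lt_left (by rw [h2v]; exact hνv), h2v]
  have hν2ne : (ν : K) + 2 ≠ 0 := (Valuation.ne_zero_iff _).mp (by rw [hν2]; exact one_ne_zero)
  have hyu : B y u = 1 := by rw [hB, huy, map_one]
  refine ⟨-(B y y) * ((ν : K) + 2)⁻¹, ?_, ?_, ?_⟩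
  · rw [Valuation.mem_integer_iff, map_mul, Valuation.map_neg, map_inv₀, hν2, inv_one, mul_one]
    exact hdv
  · simp [map_mul, map_neg, map_add, map_ofNat, hdσ, hσν]
  · have hσμ : σ (-(B y y) * ((ν : K) + 2)⁻¹) = -(B y y) * ((ν : K) + 2)⁻¹ := by
      simp [map_mul, map_neg, map_add, map_ofNat, hdσ, hσν]
    simp only [map_add, LinearMap.add_apply, apply_smul_left, apply_smul_right, hσμ, huy, hyu]
    field_simp
    linear_combination (B y y) * hνK

end Isotropy

/-! ## §4 The hyperbolic swap on a plane and the adapted hyperbolic pairs -/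

section Swap

variable {K : Type*} [Field K] [ValuativeRel K]
variable {V : Type*} [AddCommGroup V] [Module K V]
variable {σ : K →+* K} {B : V →ₛₗ[σ] V →ₗ[K] K}

omit [ValuativeRel K] in
/-- **The hyperbolic swap is an isometry.** For isotropic `a, b'` with `B(α a, b') = 1` (`α ≠ 0`), put `a' := α a`,
`b := σ(α) b'` (so `B(a, b) = B(a', b') = 1`); then `m ↦ m + B(b, m)(b' - a) + B(a, m)(a' - b)` — which is `a ↦ b'`,
`b ↦ a'`, `a' ↦ α b'`, `b' ↦ σ(α)⁻¹ α a` on the plane `⟨a, b'⟩` and the identity on its orthogonal complement — preserves `B`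
(a polynomial identity in `B(a,m), B(b',m), B(a,m'), B(b',m')`, their `σ`-conjugates and `α, σ α`). [cite: Jacobowitz1962, §4] -/
theorem hyperbolic_swap_isometry (hσσ : ∀ x, σ (σ x) = x) (hB : ∀ x y, B y x = σ (B x y))
    {a b' : V} {α : K} (hα : α ≠ 0) (haa : B a a = 0) (hb'b' : B b' b' = 0)
    (hab' : B (α • a) b' = 1) (m m' : V) :
    B (m + B (σ α • b') m • (b' - a) + B a m • (α • a - σ α • b'))
      (m' + B (σ α • b') m' • (b' - a) + B a m' • (α • a - σ α • b')) = B m m' := by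
  have hσα : σ α ≠ 0 := fun h => hα (by simpa [h] using (hσσ α).symm)
  have hτ : B a b' = (σ α)⁻¹ := by
    rw [apply_smul_left] at hab'
    exact eq_inv_of_mul_eq_one_right hab'
  have hτ' : B b' a = α⁻¹ := by rw [hB, hτ, map_inv₀, hσσ]
  have hma : B m a = σ (B a m) := hB a m
  have hmb : B m b' = σ (B b' m) := hB b' m
  have hm'a : B m' a = σ (B a m') := hB a m'
  have hm'b : B m' b' = σ (B b' m') := hB b' m'
  have hmm : B m' m = σ (B m m') := hB m m'
  simp only [map_add, map_sub, LinearMap.add_apply, LinearMap.sub_apply, apply_smul_left, apply_smul_right,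
    map_mul, map_sub, map_add, hσσ, haa, hb'b', hτ, hτ', hma, hmb]
  field_simp
  ring

variable [TopologicalSpace K] [IsNonarchimedeanLocalField K]

/-- **Hyperbolic pairs adapted to two self-dual lattices.** If `L, M` are self-dual finitely generated lattices in `W`
with `M ⊄ L`, there are `r : ℕ` (in fact the least exponent with `ϖ^r M ⊆ L`, and then `ϖ^r L ⊆ M`), an isotropic
`a ∈ M` and an isotropic `b' ∈ L` with `ϖ^r a ∈ L` and `B(ϖ^r a, b') = 1`: the first step of the elementary-divisor
theory of the pair `(L, M)`.  Construction: `x ∈ M` with `u = ϖ^r x ∈ L` primitive; a partner `y ∈ L`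
(`exists_mem_apply_eq_one`); one Hensel step makes `y` isotropic (`exists_isotropic_add_smul`); the corrections
`u ↦ u + δ f`, `y₂ ↦ y₂ - ½B(y₂,y₂) u₂` are then linear.  Odd residue characteristic; `K/K₀` may be ramified.
[cite: Jacobowitz1962, §7] -/
theorem exists_adapted_hyperbolic_pair (h2 : IsUnit (2 : 𝒪[K]))
    (hσv : ∀ x, valuation K (σ x) = valuation K x) (hσσ : ∀ x, σ (σ x) = x)
    (hB : ∀ x y, B y x = σ (B x y)) {ϖ : 𝒪[K]} (hϖ : Irreducible ϖ)
    {W : Submodule K V} {L M : Submodule 𝒪[K] V}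
    (hLW : ∀ x ∈ L, x ∈ W) (hMW : ∀ x ∈ M, x ∈ W) (hLfg : L.FG) (hMfg : M.FG)
    (hLint : ∀ x ∈ L, ∀ y ∈ L, B x y ∈ 𝒪[K]) (hLdual : ∀ y ∈ W, (∀ x ∈ L, B x y ∈ 𝒪[K]) → y ∈ L)
    (hMint : ∀ x ∈ M, ∀ y ∈ M, B x y ∈ 𝒪[K]) (hMdual : ∀ y ∈ W, (∀ x ∈ M, B x y ∈ 𝒪[K]) → y ∈ M)
    (hML : ¬ M ≤ L) :
    ∃ (r : ℕ) (a b' : V), a ∈ M ∧ b' ∈ L ∧ ((ϖ : K) ^ r) • a ∈ L ∧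
      (∀ l ∈ L, ((ϖ : K) ^ r) • l ∈ M) ∧ B a a = 0 ∧ B b' b' = 0 ∧ B (((ϖ : K) ^ r) • a) b' = 1 := by
  classical
  have hϖ0 := coe_ne_zero_of_irreducible hϖ
  have hϖv := valuation_lt_one_of_irreducible hϖ
  have hϖm : ∀ a : K, valuation K a < 1 → ∃ b ∈ 𝒪[K], a = ϖ * b :=
    fun a ha => exists_eq_mul_of_valuation_lt_one hϖ ha
  have hpow := exists_pow_mul_mem_integer hϖ
  have h2v : valuation K (2 : K) = 1 := by
    have := valuation_eq_one_of_isUnit_integer h2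
    simpa [coe_integer_two] using this
  have h20 : (2 : K) ≠ 0 := (Valuation.ne_zero_iff _).mp (by rw [h2v]; exact one_ne_zero)
  have hσ2 : σ 2 = 2 := map_ofNat σ 2
  have hσϖ0 : σ (ϖ : K) ≠ 0 := (Valuation.ne_zero_iff _).mp (by rw [hσv]; exact (Valuation.ne_zero_iff _).mpr hϖ0)
  have hσϖO : σ (ϖ : K) ∈ 𝒪[K] := by rw [Valuation.mem_integer_iff, hσv]; exact ϖ.2
  -- the minimal exponent `r ≥ 1` with `ϖ^r M ⊆ L`
  have hP : ∃ r : ℕ, ∀ m ∈ M, ((ϖ : K) ^ r) • m ∈ L :=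
    exists_pow_forall_smul_mem hσv hpow hLfg hMfg hLdual hMW
  have hr0 : Nat.find hP ≠ 0 := by
    intro h0
    apply hML
    intro m hm
    have := Nat.find_spec hP m hm
    rwa [h0, pow_zero, one_smul] at this
  obtain ⟨k, hk⟩ : ∃ k : ℕ, Nat.find hP = k + 1 := ⟨Nat.find hP - 1, by omega⟩
  have hrP : ∀ m ∈ M, ((ϖ : K) ^ Nat.find hP) • m ∈ L := Nat.find_spec hP
  have hkP : ¬ ∀ m ∈ M, ((ϖ : K) ^ k) • m ∈ L := Nat.find_min hP (by omega)
  push Not at hkP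
  obtain ⟨x, hxM, hxL⟩ := hkP
  set r := Nat.find hP with hr_def
  -- `u := ϖ^r x ∈ L` is primitive
  set u := ((ϖ : K) ^ r) • x with hu_def
  have huL : u ∈ L := hrP x hxM
  have hϖinv : (ϖ : K)⁻¹ * (ϖ : K) ^ r = (ϖ : K) ^ k := by
    rw [hk, pow_succ]
    field_simp
  have hprim : (ϖ : K)⁻¹ • u ∉ L := by
    rwa [hu_def, smul_smul, hϖinv]
  have hLM' : ∀ l ∈ L, ((ϖ : K) ^ r) • l ∈ M := fun l hl =>
    pow_smul_mem_of_forall_pow_smul_mem hσv hB hLint hMdual hLW hrP hl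
  obtain ⟨y, hyL, huy⟩ := exists_mem_apply_eq_one hσv hB hϖ hϖm hLint hLdual hLW huL hprim
  -- `B u u` is small
  have hxx : B x x ∈ 𝒪[K] := hMint x hxM x hxM
  have hxxσ : σ (B x x) = B x x := (hB x x).symm
  have hc_eq : B u u = σ ((ϖ : K) ^ r) * (((ϖ : K) ^ r) * B x x) := by
    rw [hu_def, apply_smul_left, apply_smul_right]
  have hϖr : valuation K ((ϖ : K) ^ r) < 1 := by
    rw [map_pow]
    exact pow_lt_one₀ zero_le hϖv (by omega)
  have hc : valuation K (B u u) < 1 := by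
    rw [hc_eq, map_mul, map_mul, hσv]
    calc valuation K ((ϖ : K) ^ r) * (valuation K ((ϖ : K) ^ r) * valuation K (B x x))
        ≤ valuation K ((ϖ : K) ^ r) * (1 * 1) :=
          mul_le_mul_right (mul_le_mul' hϖr.le ((Valuation.mem_integer_iff _ _).mp hxx)) _
      _ < 1 := by rw [mul_one, mul_one]; exact hϖr
  -- an isotropic `f ∈ L` paired with `u`
  obtain ⟨μ, hμO, hμσ, hff⟩ := exists_isotropic_add_smul h2 hσv hB huy hc (hLint y hyL y hyL)
  set f := y + μ • u with hf_def
  have hfL : f ∈ L := L.add_mem hyL (smul_mem_of_mem_integer hμO huL)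
  have hcσ : σ (B u u) = B u u := (hB u u).symm
  have huf : B u f = 1 + μ * B u u := by rw [hf_def, map_add, apply_smul_right, huy]
  have hufv : valuation K (B u f) = 1 := by
    rw [huf]
    exact valuation_one_add_mul_eq_one ((Valuation.mem_integer_iff _ _).mp hμO) hc
  have huf0 : B u f ≠ 0 := (Valuation.ne_zero_iff _).mp (by rw [hufv]; exact one_ne_zero)
  have hufσ : σ (B u f) = B u f := by rw [huf, map_add, map_one, map_mul, hμσ, hcσ]
  have hfu : B f u = B u f := by rw [hB u f, hufσ]
  -- the linear correction making `u` isotropic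
  set γ : K := -(B x x) * (2 * B u f)⁻¹ with hγ_def
  have hγσ : σ γ = γ := by
    simp only [hγ_def, map_mul, map_neg, map_inv₀, hσ2, hxxσ, hufσ]
  have hγO : γ ∈ 𝒪[K] := by
    rw [Valuation.mem_integer_iff, hγ_def, map_mul, Valuation.map_neg, map_inv₀, map_mul, h2v, hufv,
      mul_one, inv_one, mul_one]
    exact (Valuation.mem_integer_iff _ _).mp hxx
  set θ : K := σ ϖ * (ϖ : K)⁻¹ with hθ_def
  have hθv : valuation K θ = 1 := by
    rw [hθ_def, map_mul, map_inv₀, hσv, mul_inv_cancel₀ ((Valuation.ne_zero_iff _).mpr hϖ0)]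
  have hθO : θ ∈ 𝒪[K] := (Valuation.mem_integer_iff _ _).mpr hθv.le
  have hσϖr : (σ (ϖ : K)) ^ r = θ ^ r * (ϖ : K) ^ r := by
    rw [hθ_def, mul_pow, inv_pow, mul_assoc, inv_mul_cancel₀ (pow_ne_zero r hϖ0), mul_one]
  set δ : K := (σ (ϖ : K)) ^ r * (ϖ : K) ^ r * γ with hδ_def
  have hδσ : σ δ = δ := by
    rw [hδ_def, map_mul, map_mul, map_pow, map_pow, hσσ, hγσ]
    ring
  have hδO : δ ∈ 𝒪[K] :=
    Subring.mul_mem _ (Subring.mul_mem _ (Subring.pow_mem _ hσϖO r) (Subring.pow_mem _ ϖ.2 r)) hγO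
  set u₂ := u + δ • f with hu₂_def
  set x₂ := x + ((σ (ϖ : K)) ^ r * γ) • f with hx₂_def
  have hx₂M : x₂ ∈ M := by
    refine M.add_mem hxM ?_
    rw [hσϖr, mul_assoc, mul_comm ((ϖ : K) ^ r), ← mul_assoc, mul_smul]
    exact smul_mem_of_mem_integer (Subring.mul_mem _ (Subring.pow_mem _ hθO r) hγO) (hLM' f hfL)
  have hux₂ : ((ϖ : K) ^ r) • x₂ = u₂ := by
    rw [hx₂_def, hu₂_def, smul_add, smul_smul, hu_def, hδ_def]
    congr 1
    ring_nf
  have hu₂L : u₂ ∈ L := L.add_mem huL (smul_mem_of_mem_integer hδO hfL)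
  have hu₂u₂ : B u₂ u₂ = 0 := by
    rw [hu₂_def]
    simp only [map_add, LinearMap.add_apply, apply_smul_left, apply_smul_right, hff, hfu, hδσ]
    rw [hc_eq, hδ_def, hγ_def, map_pow]
    field_simp
    ring
  have hx₂x₂ : B x₂ x₂ = 0 := by
    have h := hu₂u₂
    rw [← hux₂, apply_smul_left, apply_smul_right, map_pow] at h
    rcases mul_eq_zero.mp h with h | h
    · exact absurd h (pow_ne_zero r hσϖ0)
    · rcases mul_eq_zero.mp h with h | h
      · exact absurd h (pow_ne_zero r hϖ0)
      · exact h
  have hprim₂ : (ϖ : K)⁻¹ • u₂ ∉ L := by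
    intro h
    apply hprim
    have heq : (ϖ : K)⁻¹ • u₂ = (ϖ : K)⁻¹ • u + ((ϖ : K)⁻¹ * δ) • f := by
      simp only [hu₂_def, smul_add, smul_smul]
    have hint : (ϖ : K)⁻¹ * δ ∈ 𝒪[K] := by
      have : (ϖ : K)⁻¹ * δ = (σ (ϖ : K)) ^ r * (ϖ : K) ^ k * γ := by
        rw [hδ_def, show (ϖ : K) ^ r = (ϖ : K) ^ k * ϖ from by rw [hk, pow_succ], inv_mul_eq_iff_eq_mul₀ hϖ0]
        ring
      rw [this]
      exact Subring.mul_mem _ (Subring.mul_mem _ (Subring.pow_mem _ hσϖO r) (Subring.pow_mem _ ϖ.2 k)) hγO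
    have h' : (ϖ : K)⁻¹ • u = (ϖ : K)⁻¹ • u₂ - ((ϖ : K)⁻¹ * δ) • f := by
      rw [heq, add_sub_cancel_right]
    rw [h']
    exact L.sub_mem h (smul_mem_of_mem_integer hint hfL)
  -- the isotropic partner `b'` of `u₂`
  obtain ⟨y₂, hy₂L, huy₂⟩ := exists_mem_apply_eq_one hσv hB hϖ hϖm hLint hLdual hLW hu₂L hprim₂
  have hy₂u₂ : B y₂ u₂ = 1 := by rw [hB, huy₂, map_one]
  have hd₂ : B y₂ y₂ ∈ 𝒪[K] := hLint y₂ hy₂L y₂ hy₂L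
  have hd₂σ : σ (B y₂ y₂) = B y₂ y₂ := (hB y₂ y₂).symm
  set μ₂ : K := -(B y₂ y₂) * (2 : K)⁻¹ with hμ₂_def
  have hμ₂σ : σ μ₂ = μ₂ := by rw [hμ₂_def, map_mul, map_neg, map_inv₀, hσ2, hd₂σ]
  have hμ₂O : μ₂ ∈ 𝒪[K] := by
    rw [Valuation.mem_integer_iff, hμ₂_def, map_mul, Valuation.map_neg, map_inv₀, h2v, inv_one, mul_one]
    exact (Valuation.mem_integer_iff _ _).mp hd₂
  set b' := y₂ + μ₂ • u₂ with hb'_def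
  have hb'L : b' ∈ L := L.add_mem hy₂L (smul_mem_of_mem_integer hμ₂O hu₂L)
  have hb'b' : B b' b' = 0 := by
    rw [hb'_def]
    simp only [map_add, LinearMap.add_apply, apply_smul_left, apply_smul_right, huy₂, hy₂u₂, hu₂u₂, hμ₂σ]
    rw [hμ₂_def]
    field_simp
    ring
  have hu₂b' : B u₂ b' = 1 := by
    rw [hb'_def, map_add, apply_smul_right, huy₂, hu₂u₂, mul_zero, add_zero]
  refine ⟨r, x₂, b', hx₂M, hb'L, by rw [hux₂]; exact hu₂L, hLM', hx₂x₂, hb'b', by rw [hux₂]; exact hu₂b'⟩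

end Swap

/-! ## §5 The swap theorem -/

section Main

variable {K : Type*} [Field K] [ValuativeRel K]
variable {V : Type*} [AddCommGroup V] [Module K V]
variable {σ : K →+* K} {B : V →ₛₗ[σ] V →ₗ[K] K}

/-- **Self-duality passes to the orthogonal complement of a hyperbolic pair**: if `X` is self-dual in `W` and contains
the hyperbolic pair `(c, d)`, `P = ⟨c, d⟩^⊥`, then `X ∩ P` is self-dual in `W ∩ P` (test vectors decompose along
`c, d` with integral coefficients). [cite: Jacobowitz1962, §4] -/
theorem mem_inf_of_dual_orthogonal (hB : ∀ x y, B y x = σ (B x y)) {W : Submodule K V}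
    {X : Submodule 𝒪[K] V} (hXint : ∀ x ∈ X, ∀ y ∈ X, B x y ∈ 𝒪[K])
    (hXdual : ∀ y ∈ W, (∀ x ∈ X, B x y ∈ 𝒪[K]) → y ∈ X)
    {c d : V} (hcc : B c c = 0) (hdd : B d d = 0) (hcd : B c d = 1) (hc : c ∈ X) (hd : d ∈ X)
    {P : Submodule K V} (hP : ∀ z, z ∈ P ↔ B c z = 0 ∧ B d z = 0)
    {y : V} (hy : y ∈ W ⊓ P) (hyX : ∀ x ∈ X ⊓ P.restrictScalars 𝒪[K], B x y ∈ 𝒪[K]) :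
    y ∈ X ⊓ P.restrictScalars 𝒪[K] := by
  refine ⟨hXdual y hy.1 fun x hx => ?_, hy.2⟩
  obtain ⟨h1, h2⟩ := hyperbolic_residual_ortho σ B hB hcc hdd hcd x
  have hqX := hyperbolic_residual_mem σ B hXint hc hd hx
  have hqP : x - (B d x) • c - (B c x) • d ∈ P := (hP _).mpr ⟨h1, h2⟩
  have hy' := (hP y).mp hy.2
  have hsum : x = (x - (B d x) • c - (B c x) • d) + (B d x) • c + (B c x) • d := by abel
  rw [hsum, map_add, map_add, LinearMap.add_apply, LinearMap.add_apply, apply_smul_left, apply_smul_left,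
    hy'.1, hy'.2, mul_zero, mul_zero, add_zero, add_zero]
  exact hyX _ ⟨hqX, hqP⟩

variable [TopologicalSpace K] [IsNonarchimedeanLocalField K]

/-- **The swap theorem for self-dual Hermitian lattices.** `K` a non-archimedean local field with `2 ∈ 𝒪[K]ˣ`, `σ` a
valuation-preserving ring endomorphism with `σ ∘ σ = id`, `B` a `σ`-Hermitian form on the finite-dimensional space `V`,
`W ≤ V` a subspace and `L, M ≤ W` finitely generated `𝒪[K]`-lattices, both integral and self-dual in `W`.  Then there
is a `K`-linear isometry `s` of `(V, B)` (`B(s x, s y) = B(x, y)`), equal to the identity on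
`W^⊥ = {z | B(W, z) = 0}`, with `s(L) = M` and `s(M) = L`.  Proof by induction on `dim W`: `M ⊆ L` forces `M = L`
(duality) and `s = id`; otherwise split off the plane of an adapted hyperbolic pair (`exists_adapted_hyperbolic_pair`,
`hyperbolic_swap_isometry`) and recurse in `W ∩ ⟨a, b⟩^⊥`, where `L ∩ P^⊥`, `M ∩ P^⊥` are again self-dual
(`mem_inf_of_dual_orthogonal`).  For `L = L₀`, `M = g L₀` (`g ∈ U(B)`) this is `g⁻¹ ∈ U(L₀) g U(L₀)`, the
symmetry of the double cosets of the (hyper)special subgroup `U(L₀)` classically read off the Cartan decomposition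
([BruhatTits1972] 4.4.3); here it is obtained without torus, Weyl element or classification of unimodular lattices.
[cite: Jacobowitz1962, §7] -/
theorem exists_isometry_swap [FiniteDimensional K V] (h2 : IsUnit (2 : 𝒪[K]))
    (hσv : ∀ x, valuation K (σ x) = valuation K x) (hσσ : ∀ x, σ (σ x) = x)
    (hB : ∀ x y, B y x = σ (B x y)) (W : Submodule K V) (L M : Submodule 𝒪[K] V)
    (hLW : ∀ x ∈ L, x ∈ W) (hMW : ∀ x ∈ M, x ∈ W) (hLfg : L.FG) (hMfg : M.FG)
    (hLint : ∀ x ∈ L, ∀ y ∈ L, B x y ∈ 𝒪[K]) (hLdual : ∀ y ∈ W, (∀ x ∈ L, B x y ∈ 𝒪[K]) → y ∈ L)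
    (hMint : ∀ x ∈ M, ∀ y ∈ M, B x y ∈ 𝒪[K]) (hMdual : ∀ y ∈ W, (∀ x ∈ M, B x y ∈ 𝒪[K]) → y ∈ M) :
    ∃ s : V →ₗ[K] V, (∀ x y, B (s x) (s y) = B x y) ∧ (∀ z, (∀ w ∈ W, B w z = 0) → s z = z) ∧
      L.map (s.restrictScalars 𝒪[K]) = M ∧ M.map (s.restrictScalars 𝒪[K]) = L := by
  classical
  obtain ⟨ϖ, hϖ⟩ := IsDiscreteValuationRing.exists_irreducible 𝒪[K]
  have hϖ0 := coe_ne_zero_of_irreducible hϖ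
  suffices key : ∀ (n : ℕ) (W : Submodule K V), Module.finrank K W = n →
      ∀ (L M : Submodule 𝒪[K] V), (∀ x ∈ L, x ∈ W) → (∀ x ∈ M, x ∈ W) → L.FG → M.FG →
      (∀ x ∈ L, ∀ y ∈ L, B x y ∈ 𝒪[K]) → (∀ y ∈ W, (∀ x ∈ L, B x y ∈ 𝒪[K]) → y ∈ L) →
      (∀ x ∈ M, ∀ y ∈ M, B x y ∈ 𝒪[K]) → (∀ y ∈ W, (∀ x ∈ M, B x y ∈ 𝒪[K]) → y ∈ M) →
      ∃ s : V →ₗ[K] V, (∀ x y, B (s x) (s y) = B x y) ∧ (∀ z, (∀ w ∈ W, B w z = 0) → s z = z) ∧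
        L.map (s.restrictScalars 𝒪[K]) = M ∧ M.map (s.restrictScalars 𝒪[K]) = L from
    key _ W rfl L M hLW hMW hLfg hMfg hLint hLdual hMint hMdual
  intro n
  induction n using Nat.strong_induction_on with
  | _ n ih =>
  intro W hn L M hLW hMW hLfg hMfg hLint hLdual hMint hMdual
  by_cases hML : M ≤ L
  · -- then `M = L` by duality, and the identity swaps
    have hLM : L ≤ M := fun l hl => hMdual l (hLW l hl) fun m hm => hLint m (hML hm) l hl
    have hEq : L = M := le_antisymm hLM hML
    refine ⟨LinearMap.id, fun x y => rfl, fun z _ => rfl, ?_, ?_⟩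
    · subst hEq; ext x; simp
    · subst hEq; ext x; simp
  -- adapted hyperbolic pairs
  obtain ⟨r, a, b', haM, hb'L, ha'L, hLM', haa, hb'b', ha'b'⟩ :=
    exists_adapted_hyperbolic_pair h2 hσv hσσ hB hϖ hLW hMW hLfg hMfg hLint hLdual hMint hMdual hML
  -- notation-free abbreviations: `α := ϖ^r`, `a' := α • a ∈ L`, `b := σ α • b' ∈ M`
  have hα : ((ϖ : K) ^ r) ≠ 0 := pow_ne_zero r hϖ0
  have hσα : σ ((ϖ : K) ^ r) ≠ 0 := fun h => hα (by simpa [h] using (hσσ ((ϖ : K) ^ r)).symm)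
  have hσϖO : σ (ϖ : K) ∈ 𝒪[K] := by rw [Valuation.mem_integer_iff, hσv]; exact ϖ.2
  have hab' : B a b' = (σ ((ϖ : K) ^ r))⁻¹ := by
    have h := ha'b'
    rw [apply_smul_left] at h
    exact eq_inv_of_mul_eq_one_right h
  have hab : B a (σ ((ϖ : K) ^ r) • b') = 1 := by
    rw [apply_smul_right, hab', mul_inv_cancel₀ hσα]
  have hba : B (σ ((ϖ : K) ^ r) • b') a = 1 := by rw [hB, hab, map_one]
  have hb'a' : B b' (((ϖ : K) ^ r) • a) = 1 := by rw [hB, ha'b', map_one]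
  have hbb : B (σ ((ϖ : K) ^ r) • b') (σ ((ϖ : K) ^ r) • b') = 0 := by
    rw [apply_smul_left, apply_smul_right, hb'b', mul_zero, mul_zero]
  have ha'a' : B (((ϖ : K) ^ r) • a) (((ϖ : K) ^ r) • a) = 0 := by
    rw [apply_smul_left, apply_smul_right, haa, mul_zero, mul_zero]
  -- `b ∈ M`: `σ(ϖ)^r • b' = (σϖ/ϖ)^r • (ϖ^r • b')`
  set θ : K := σ ϖ * (ϖ : K)⁻¹ with hθ_def
  have hθv : valuation K θ = 1 := by
    rw [hθ_def, map_mul, map_inv₀, hσv, mul_inv_cancel₀ ((Valuation.ne_zero_iff _).mpr hϖ0)]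
  have hθO : θ ∈ 𝒪[K] := (Valuation.mem_integer_iff _ _).mpr hθv.le
  have hθinvO : θ⁻¹ ∈ 𝒪[K] := inv_mem_integer_of_valuation_eq_one hθv
  have hθ0 : θ ≠ 0 := (Valuation.ne_zero_iff _).mp (by rw [hθv]; exact one_ne_zero)
  have hσαθ : σ ((ϖ : K) ^ r) = θ ^ r * (ϖ : K) ^ r := by
    rw [map_pow, hθ_def, mul_pow, inv_pow, mul_assoc, inv_mul_cancel₀ hα, mul_one]
  have hbM : σ ((ϖ : K) ^ r) • b' ∈ M := by
    rw [hσαθ, mul_smul]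
    exact smul_mem_of_mem_integer (Subring.pow_mem _ hθO r) (hLM' b' hb'L)
  -- the common orthogonal complement of the two pairs
  set Pp : Submodule K V := LinearMap.ker (B a) ⊓ LinearMap.ker (B (σ ((ϖ : K) ^ r) • b')) with hPp_def
  have hPp : ∀ z, z ∈ Pp ↔ B a z = 0 ∧ B (σ ((ϖ : K) ^ r) • b') z = 0 := fun z => by
    simp only [hPp_def, Submodule.mem_inf, LinearMap.mem_ker]
  have hPp' : ∀ z, z ∈ Pp ↔ B (((ϖ : K) ^ r) • a) z = 0 ∧ B b' z = 0 := fun z => by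
    rw [hPp z, apply_smul_left, apply_smul_left, hσσ, mul_eq_zero, mul_eq_zero, or_iff_right hσα,
      or_iff_right hα]
  -- the smaller ambient space
  have hlt : W ⊓ Pp < W := by
    refine lt_of_le_of_ne inf_le_left fun h => ?_
    have haW : a ∈ W ⊓ Pp := h.symm ▸ hMW a haM
    have := ((hPp a).mp haW.2).2
    rw [hba] at this
    exact one_ne_zero this
  have hfin : Module.finrank K ↥(W ⊓ Pp) < n := hn ▸ Submodule.finrank_lt_finrank_of_lt hlt
  -- the lattices `L₁ = L ∩ P^⊥`, `M₁ = M ∩ P^⊥` are self-dual in `W ∩ P^⊥`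
  have hL₁dual : ∀ y ∈ W ⊓ Pp, (∀ x ∈ L ⊓ Pp.restrictScalars 𝒪[K], B x y ∈ 𝒪[K]) →
      y ∈ L ⊓ Pp.restrictScalars 𝒪[K] := fun y hy hyX =>
    mem_inf_of_dual_orthogonal hB hLint hLdual ha'a' hb'b' ha'b' ha'L hb'L hPp' hy hyX
  have hM₁dual : ∀ y ∈ W ⊓ Pp, (∀ x ∈ M ⊓ Pp.restrictScalars 𝒪[K], B x y ∈ 𝒪[K]) →
      y ∈ M ⊓ Pp.restrictScalars 𝒪[K] := fun y hy hyX =>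
    mem_inf_of_dual_orthogonal hB hMint hMdual haa hbb hab haM hbM hPp hy hyX
  obtain ⟨s₁, hs₁B, hs₁fix, hs₁L, hs₁M⟩ := ih _ hfin (W ⊓ Pp) rfl (L ⊓ Pp.restrictScalars 𝒪[K])
    (M ⊓ Pp.restrictScalars 𝒪[K]) (fun x hx => ⟨hLW x hx.1, hx.2⟩) (fun x hx => ⟨hMW x hx.1, hx.2⟩)
    (hLfg.of_le inf_le_left) (hMfg.of_le inf_le_left)
    (fun x hx y hy => hLint x hx.1 y hy.1) hL₁dual (fun x hx y hy => hMint x hx.1 y hy.1) hM₁dual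
  -- `s₁` fixes the plane of `a, b'`
  have hs₁a : s₁ a = a := hs₁fix a fun w hw => by rw [hB, ((hPp w).mp hw.2).1, map_zero]
  have hs₁b' : s₁ b' = b' := hs₁fix b' fun w hw => by rw [hB, ((hPp' w).mp hw.2).2, map_zero]
  -- the swap
  set φ : V →ₗ[K] V := LinearMap.id + (B (σ ((ϖ : K) ^ r) • b')).smulRight (b' - a) +
    (B a).smulRight (((ϖ : K) ^ r) • a - σ ((ϖ : K) ^ r) • b') with hφ_def
  have hφ : ∀ m, φ m = m + B (σ ((ϖ : K) ^ r) • b') m • (b' - a) +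
      B a m • (((ϖ : K) ^ r) • a - σ ((ϖ : K) ^ r) • b') := fun m => rfl
  have hφB : ∀ m m', B (φ m) (φ m') = B m m' := fun m m' => by
    rw [hφ, hφ]
    exact hyperbolic_swap_isometry hσσ hB hα haa hb'b' ha'b' m m'
  have hφfix : ∀ z, B a z = 0 → B (σ ((ϖ : K) ^ r) • b') z = 0 → φ z = z := fun z h1 h2 => by
    rw [hφ, h1, h2, zero_smul, zero_smul, add_zero, add_zero]
  have hφa : φ a = b' := by
    rw [hφ, hba, haa, one_smul, zero_smul, add_zero, add_sub_cancel]
  have hφb : φ (σ ((ϖ : K) ^ r) • b') = ((ϖ : K) ^ r) • a := by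
    rw [hφ, hbb, hab, zero_smul, add_zero, one_smul, add_sub_cancel]
  have hφa' : φ (((ϖ : K) ^ r) • a) = ((ϖ : K) ^ r) • b' := by
    rw [hφ, apply_smul_right, hba, mul_one, apply_smul_right, haa, mul_zero, zero_smul, add_zero, smul_sub,
      add_sub_cancel]
  have hφb'' : φ b' = ((σ ((ϖ : K) ^ r))⁻¹ * (ϖ : K) ^ r) • a := by
    rw [hφ, apply_smul_left, hb'b', mul_zero, zero_smul, add_zero, hab', smul_sub, smul_smul, smul_smul,
      inv_mul_cancel₀ hσα, one_smul, add_sub, add_sub_cancel_left]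
  -- the swap `s := s₁ ∘ φ`
  have hsB : ∀ m m', B ((s₁ ∘ₗ φ) m) ((s₁ ∘ₗ φ) m') = B m m' := fun m m' => by
    rw [LinearMap.comp_apply, LinearMap.comp_apply, hs₁B, hφB]
  have hsfix : ∀ z, (∀ w ∈ W, B w z = 0) → (s₁ ∘ₗ φ) z = z := fun z hz => by
    rw [LinearMap.comp_apply, hφfix z (hz a (hMW a haM)) (hz _ (hMW _ hbM))]
    exact hs₁fix z fun w hw => hz w hw.1
  have hsa : (s₁ ∘ₗ φ) a = b' := by rw [LinearMap.comp_apply, hφa, hs₁b']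
  have hsb : (s₁ ∘ₗ φ) (σ ((ϖ : K) ^ r) • b') = ((ϖ : K) ^ r) • a := by
    rw [LinearMap.comp_apply, hφb, map_smul, hs₁a]
  have hsa' : (s₁ ∘ₗ φ) (((ϖ : K) ^ r) • a) = ((ϖ : K) ^ r) • b' := by
    rw [LinearMap.comp_apply, hφa', map_smul, hs₁b']
  have hsb' : (s₁ ∘ₗ φ) b' = ((σ ((ϖ : K) ^ r))⁻¹ * (ϖ : K) ^ r) • a := by
    rw [LinearMap.comp_apply, hφb'', map_smul, hs₁a]
  have hsq : ∀ q, q ∈ Pp → (s₁ ∘ₗ φ) q = s₁ q := fun q hq => by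
    rw [LinearMap.comp_apply, hφfix q ((hPp q).mp hq).1 ((hPp q).mp hq).2]
  -- the unit `κ := σ(α)⁻¹ α`
  have hκ : valuation K ((σ ((ϖ : K) ^ r))⁻¹ * (ϖ : K) ^ r) = 1 := by
    rw [map_mul, map_inv₀, hσv, inv_mul_cancel₀ ((Valuation.ne_zero_iff _).mpr hα)]
  have hκO : (σ ((ϖ : K) ^ r))⁻¹ * (ϖ : K) ^ r ∈ 𝒪[K] := (Valuation.mem_integer_iff _ _).mpr hκ.le
  have hκinvO : ((σ ((ϖ : K) ^ r))⁻¹ * (ϖ : K) ^ r)⁻¹ ∈ 𝒪[K] := inv_mem_integer_of_valuation_eq_one hκ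
  have hκ0 : (σ ((ϖ : K) ^ r))⁻¹ * (ϖ : K) ^ r ≠ 0 := (Valuation.ne_zero_iff _).mp (by rw [hκ]; exact one_ne_zero)
  -- the four inclusions
  have I1 : L ≤ M.comap ((s₁ ∘ₗ φ).restrictScalars 𝒪[K]) := by
    refine le_of_hyperbolic_pair σ B hB ha'a' hb'b' ha'b' ha'L hb'L hLint ?_ ?_ ?_
    · change (s₁ ∘ₗ φ) (((ϖ : K) ^ r) • a) ∈ M
      rw [hsa']
      exact hLM' b' hb'L
    · change (s₁ ∘ₗ φ) b' ∈ M
      rw [hsb']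
      exact smul_mem_of_mem_integer hκO haM
    · intro q hq h1 h2
      have hqP : q ∈ Pp := (hPp' q).mpr ⟨h1, h2⟩
      change (s₁ ∘ₗ φ) q ∈ M
      rw [hsq q hqP]
      have hmem : s₁ q ∈ (L ⊓ Pp.restrictScalars 𝒪[K]).map (s₁.restrictScalars 𝒪[K]) :=
        Submodule.mem_map_of_mem ⟨hq, hqP⟩
      rw [hs₁L] at hmem
      exact hmem.1
  have I2 : M ≤ L.comap ((s₁ ∘ₗ φ).restrictScalars 𝒪[K]) := by
    refine le_of_hyperbolic_pair σ B hB haa hbb hab haM hbM hMint ?_ ?_ ?_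
    · change (s₁ ∘ₗ φ) a ∈ L
      rw [hsa]
      exact hb'L
    · change (s₁ ∘ₗ φ) (σ ((ϖ : K) ^ r) • b') ∈ L
      rw [hsb]
      exact ha'L
    · intro q hq h1 h2
      have hqP : q ∈ Pp := (hPp q).mpr ⟨h1, h2⟩
      change (s₁ ∘ₗ φ) q ∈ L
      rw [hsq q hqP]
      have hmem : s₁ q ∈ (M ⊓ Pp.restrictScalars 𝒪[K]).map (s₁.restrictScalars 𝒪[K]) :=
        Submodule.mem_map_of_mem ⟨hq, hqP⟩
      rw [hs₁M] at hmem
      exact hmem.1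
  have I3 : M ≤ L.map ((s₁ ∘ₗ φ).restrictScalars 𝒪[K]) := by
    refine le_of_hyperbolic_pair σ B hB haa hbb hab haM hbM hMint ?_ ?_ ?_
    · refine Submodule.mem_map.mpr ⟨((σ ((ϖ : K) ^ r))⁻¹ * (ϖ : K) ^ r)⁻¹ • b',
        smul_mem_of_mem_integer hκinvO hb'L, ?_⟩
      rw [LinearMap.restrictScalars_apply, map_smul, hsb', smul_smul, inv_mul_cancel₀ hκ0, one_smul]
    · refine Submodule.mem_map.mpr ⟨(σ ((ϖ : K) ^ r) * ((ϖ : K) ^ r)⁻¹) • (((ϖ : K) ^ r) • a),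
        smul_mem_of_mem_integer ?_ ha'L, ?_⟩
      · rw [hσαθ, mul_assoc, mul_inv_cancel₀ hα, mul_one]
        exact Subring.pow_mem _ hθO r
      · rw [LinearMap.restrictScalars_apply, map_smul, hsa', smul_smul, mul_assoc, inv_mul_cancel₀ hα,
          mul_one]
    · intro q hq h1 h2
      have hqP : q ∈ Pp := (hPp q).mpr ⟨h1, h2⟩
      have hmem : q ∈ (L ⊓ Pp.restrictScalars 𝒪[K]).map (s₁.restrictScalars 𝒪[K]) := by
        rw [hs₁L]
        exact ⟨hq, hqP⟩
      obtain ⟨l, hl, hlq⟩ := Submodule.mem_map.mp hmem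
      refine Submodule.mem_map.mpr ⟨l, hl.1, ?_⟩
      rw [LinearMap.restrictScalars_apply, hsq l hl.2]
      exact hlq
  have I4 : L ≤ M.map ((s₁ ∘ₗ φ).restrictScalars 𝒪[K]) := by
    refine le_of_hyperbolic_pair σ B hB ha'a' hb'b' ha'b' ha'L hb'L hLint ?_ ?_ ?_
    · exact Submodule.mem_map.mpr ⟨σ ((ϖ : K) ^ r) • b', hbM, hsb⟩
    · exact Submodule.mem_map.mpr ⟨a, haM, hsa⟩
    · intro q hq h1 h2
      have hqP : q ∈ Pp := (hPp' q).mpr ⟨h1, h2⟩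
      have hmem : q ∈ (M ⊓ Pp.restrictScalars 𝒪[K]).map (s₁.restrictScalars 𝒪[K]) := by
        rw [hs₁M]
        exact ⟨hq, hqP⟩
      obtain ⟨m, hm, hmq⟩ := Submodule.mem_map.mp hmem
      refine Submodule.mem_map.mpr ⟨m, hm.1, ?_⟩
      rw [LinearMap.restrictScalars_apply, hsq m hm.2]
      exact hmq
  exact ⟨s₁ ∘ₗ φ, hsB, hsfix, le_antisymm (Submodule.map_le_iff_le_comap.mpr I1) I3,
    le_antisymm (Submodule.map_le_iff_le_comap.mpr I2) I4⟩

end Main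

end Literature.NumberTheory.QuadraticForms.SelfDualLattice
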